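import Mathlib
import HarnessLib
import Summits.AtomisticToContinuum.HydrodynamicLimit.Theorems.RelayRaceLocalityConeLocalisationLocalDefs
import Summits.AtomisticToContinuum.HydrodynamicLimit.Theorems.RelayRaceLocalityNearConstantShortTimeHLTorusLipschitz
import Literature.Analysis.FunctionSpaces.TorusPlateauCutoff
import Literature.Analysis.FunctionSpaces.TorusLiftDerivBounds
import Literature.Analysis.FunctionSpaces.TorusLowOrderLeibniz
import Literature.Analysis.FluidPDE.HardSpherePhaseSpaceProofs
import Literature.Analysis.FluidPDE.HardSphereRegularGeometry
import Literature.Analysis.FluidPDE.ConfinedHardSphereFlowShortBad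
import Literature.MathematicalPhysics.KineticTheory.HardSphereEulerLevelEnergies

/-!
# RelayRaceLocality · ConeLocalisation — stub `stub_flatteningLinear : FlatteningLinear`

Support file for the crux item `stmt-AtomisticToContinuum-12504` (`ConeLocalisation`, route
RelayRaceLocality of `AtomisticToContinuum/HydrodynamicLimit`), line `Sketch` (zoomed-bubble-transplant),
stub `stub_flatteningLinear` of the skeleton: the smooth cutoffs `ψ = ψ(r, c)` on `𝕋³` (`= 1` on the
minimal-image ball `B(c, r)`, `= 0` off `B(c, 3r/2) ⊆ B(c, 2r)`, `|∂ᵏψ| ≤ Cψ r^{-k}`, `k ≤ 3`, ONE constant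
for all `0 < r ≤ 1/16` and all centres) and the scale-`r` bounds (`ScaleDeviation(V)`) of the linear
flattenings `ψ f + (1 - ψ) f(c)` of scalar and vector fields with `C⁰…C³` bounds `M`.

Route (folklore; Evans, *PDE*, App. C.4 and §5.3):
* `flatLin_exists_cutoff` — the plateau cut-off `Torus.exists_plateau_cutoff` of the set
  `S = {euclidDist(·, c) < r}` at sup-metric scale `δ = r/(10√3)` (`thickening δ S ⊇ S`,
  `thickening (5δ) S ⊆ {euclidDist(·, c) < 3r/2}` since `euclidDist ≤ √3·dist`), whose all-orders lift bounds
  `‖Dⁿ(ψ∘proj)‖ ≤ c_n δ⁻ⁿ` are read out on nested `Torus.partialDeriv`s by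
  `HsEulerStability.torus_partialDeriv_iter_le_of_lift_bounds`; `Cψ⁰ = c̄₃ (10√3)³`.
* `flatLin_leibniz_bounds` — the explicit Leibniz formulas of orders `1, 2, 3` for `ψ • h`
  (`Torus.partialDeriv{,₂,₃}_smul_sub`) turned into pointwise bounds.
* `flatLin_flatten` — `g - f(c) = ψ • (f - f(c))`; off `B(c, 3r/2)` the product vanishes identically, so all
  its derivatives vanish (locality of `Torus.partialDeriv`); on `B(c, 3r/2)` the smallness
  `‖f x - f c‖ ≤ 3M·dist x c ≤ 3M·euclidDist x c ≤ 6Mr` (`we_norm_sub_le_of_norm_partialDeriv_le`,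
  `Torus.norm_sub_le_euclidDist_holds`) pays for the `r⁻¹` of every derivative falling on `ψ`; final constant
  `Cψ = 12 Cψ⁰ + 6`.
-/

noncomputable section

namespace Summit.AtomisticToContinuum.HydrodynamicLimit.Theorems.ConeLocalisation

open scoped Topology
open Filter Set MeasureTheory
open Literature.MathematicalPhysics.KineticTheory Literature.Analysis.FluidPDE
  Literature.Analysis.FunctionSpaces
open Summit.AtomisticToContinuum.HydrodynamicLimit.Theses.RelayRaceLocality
open Summit.AtomisticToContinuum.HydrodynamicLimit.Theorems.NearConstantShortTimeHL

/-! ## The cutoffs -/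

/-- **Smooth cutoffs on `𝕋³` at scale `r` around `c` with `r`-free constants.** There is `A ≥ 1` such
that for all `0 < r ≤ 1/16` and `c ∈ 𝕋³` there is a smooth `ψ : 𝕋³ → [0, 1]`, `= 1` on the minimal-image
ball `{euclidDist(·, c) < r}`, `= 0` on `{3r/2 ≤ euclidDist(·, c)}`, with `|∂ψ| ≤ A/r`, `|∂²ψ| ≤ A/r²`,
`|∂³ψ| ≤ A/r³` (mollified plateau cut-off, Evans App. C.4 Thm. 7). [folklore] -/
theorem flatLin_exists_cutoff : ∃ A : ℝ, 1 ≤ A ∧ ∀ r : ℝ, 0 < r → r ≤ 1 / 16 → ∀ c : T3,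
    ∃ ψ : T3 → ℝ, Torus.IsSmooth ψ ∧ (∀ x, 0 ≤ ψ x ∧ ψ x ≤ 1) ∧
      (∀ x, Torus.euclidDist x c < r → ψ x = 1) ∧ (∀ x, 3 / 2 * r ≤ Torus.euclidDist x c → ψ x = 0) ∧
      ∀ x, ∀ i j k : Fin 3, |Torus.partialDeriv i ψ x| ≤ A / r ∧
        |Torus.partialDeriv i (Torus.partialDeriv j ψ) x| ≤ A / r ^ 2 ∧
        |Torus.partialDeriv i (Torus.partialDeriv j (Torus.partialDeriv k ψ)) x| ≤ A / r ^ 3 := by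
  set K : ℝ := 10 * Real.sqrt 3 with hK
  have hs : 0 < Real.sqrt 3 := Real.sqrt_pos.2 (by norm_num)
  have hs1 : 1 ≤ Real.sqrt 3 := Real.one_le_sqrt.2 (by norm_num)
  have hK1 : 1 ≤ K := by rw [hK]; nlinarith
  have hK0 : 0 < K := one_pos.trans_le hK1
  set cbar : ℝ := Torus.derivProfileMassSup (Fin 3) 3 with hcbar
  have hc1 : 1 ≤ cbar := Torus.one_le_derivProfileMassSup 3
  refine ⟨cbar * K ^ 3, one_le_mul_of_one_le_of_one_le hc1 (one_le_pow₀ hK1), fun r hr hr16 c => ?_⟩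
  have hδ : 0 < r / K := div_pos hr hK0
  have hδ' : r / K ≤ 1 / 4 := (div_le_self hr.le hK1).trans (hr16.trans (by norm_num))
  obtain ⟨χ, hχs, hχ01, hχ1, hχ0, hχD⟩ :=
    Torus.exists_plateau_cutoff (S := {x : T3 | Torus.euclidDist x c < r}) hδ hδ'
  refine ⟨χ, hχs, hχ01, fun x hx => hχ1 x (Metric.self_subset_thickening hδ _ hx),
    fun x hx => hχ0 x fun hx' => ?_, fun x i j k => ?_⟩
  · -- `thickening (5δ) S ⊆ {euclidDist(·, c) < 3r/2}`
    obtain ⟨z, hz, hxz⟩ := Metric.mem_thickening_iff.1 hx'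
    have hz' : Torus.euclidDist z c < r := hz
    have h1 : Torus.euclidDist x z ≤ Real.sqrt 3 * dist x z := by
      have h := Torus.euclidDist_le_holds x z
      rw [dist_eq_norm]
      simpa [Fintype.card_fin] using h
    have h2 := Torus.euclidDist_triangle x z c
    have h3 : Real.sqrt 3 * (5 * (r / K)) = r / 2 := by
      rw [hK]; field_simp; ring
    have h4 : Real.sqrt 3 * dist x z < r / 2 := by
      rw [← h3]; exact mul_lt_mul_of_pos_left hxz hs
    linarith
  · -- derivative bounds from the all-orders lift bounds
    have hB := HsEulerStability.torus_partialDeriv_iter_le_of_lift_bounds hχs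
      (M := fun n => Torus.derivProfileMass (Fin 3) n * ((r / K) ^ n)⁻¹) (fun n _ y => hχD n y) x i j k i
    have hle : ∀ n : ℕ, n ≤ 3 →
        Torus.derivProfileMass (Fin 3) n * ((r / K) ^ n)⁻¹ ≤ cbar * K ^ 3 / r ^ n := by
      intro n hn
      rw [div_pow, inv_div, ← mul_div_assoc]
      refine div_le_div_of_nonneg_right ?_ (pow_pos hr n).le
      exact mul_le_mul (Torus.derivProfileMass_le_sup hn) (pow_le_pow_right₀ hK1 hn) (pow_pos hK0 n).le
        (zero_le_one.trans hc1)
    refine ⟨hB.1.trans ?_, hB.2.1.trans (hle 2 (by norm_num)), hB.2.2.1.trans (hle 3 le_rfl)⟩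
    simpa using hle 1 (by norm_num)

/-! ## Locality and Leibniz bounds for `Torus.partialDeriv` -/

/-- Locality: a function vanishing on an open set of `𝕋³` has vanishing partial derivatives there.
[folklore] -/
theorem flatLin_partialDeriv_eq_zero_of_isOpen {F : Type*} [NormedAddCommGroup F] [NormedSpace ℝ F]
    {U : Set T3} (hU : IsOpen U) {P : T3 → F} (hP : ∀ y ∈ U, P y = 0) (i : Fin 3) :
    ∀ y ∈ U, Torus.partialDeriv i P y = 0 := by
  intro y hy
  have hc : Tendsto (fun t : ℝ => y + Torus.proj (t • EuclideanSpace.single i (1 : ℝ))) (𝓝 0) (𝓝 y) := by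
    have hcont : Continuous fun t : ℝ => y + Torus.proj (t • EuclideanSpace.single i (1 : ℝ)) :=
      continuous_const.add (Torus.continuous_proj.comp (continuous_id.smul continuous_const))
    have h0 := hcont.continuousAt (x := 0)
    rwa [ContinuousAt, zero_smul, Torus.proj_zero, add_zero] at h0
  have hev : (fun t : ℝ => P (y + Torus.proj (t • EuclideanSpace.single i (1 : ℝ)))) =ᶠ[𝓝 0]
      fun _ => (0 : F) :=
    hc.eventually (Filter.eventually_of_mem (hU.mem_nhds hy) hP)
  unfold Torus.partialDeriv Torus.lineDeriv
  rw [hev.deriv_eq]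
  simp

/-- Iterated locality: first, second and third nested partial derivatives of a function vanishing on an
open set vanish there. [folklore] -/
theorem flatLin_derivs_eq_zero_of_isOpen {F : Type*} [NormedAddCommGroup F] [NormedSpace ℝ F]
    {U : Set T3} (hU : IsOpen U) {P : T3 → F} (hP : ∀ y ∈ U, P y = 0) (i j k : Fin 3) {x : T3}
    (hx : x ∈ U) :
    Torus.partialDeriv i P x = 0 ∧ Torus.partialDeriv i (Torus.partialDeriv j P) x = 0 ∧
      Torus.partialDeriv i (Torus.partialDeriv j (Torus.partialDeriv k P)) x = 0 := by
  have h1 : ∀ j, ∀ y ∈ U, Torus.partialDeriv j P y = 0 := fun j =>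
    flatLin_partialDeriv_eq_zero_of_isOpen hU hP j
  have h2 : ∀ i j, ∀ y ∈ U, Torus.partialDeriv i (Torus.partialDeriv j P) y = 0 := fun i j =>
    flatLin_partialDeriv_eq_zero_of_isOpen hU (h1 j) i
  exact ⟨h1 i x hx, h2 i j x hx, flatLin_partialDeriv_eq_zero_of_isOpen hU (h2 j k) i x hx⟩

/-- Adding a constant does not change partial derivatives. [folklore] -/
theorem flatLin_partialDeriv_add_const {F : Type*} [NormedAddCommGroup F] [NormedSpace ℝ F]
    (P : T3 → F) (a : F) (i : Fin 3) : Torus.partialDeriv i (fun x => P x + a) = Torus.partialDeriv i P := by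
  funext x
  simp only [Torus.partialDeriv, Torus.lineDeriv, deriv_add_const]

/-- Subtracting a constant does not change partial derivatives. [folklore] -/
theorem flatLin_partialDeriv_sub_const {F : Type*} [NormedAddCommGroup F] [NormedSpace ℝ F]
    (P : T3 → F) (a : F) (i : Fin 3) : Torus.partialDeriv i (fun x => P x - a) = Torus.partialDeriv i P := by
  funext x
  simp only [Torus.partialDeriv, Torus.lineDeriv, deriv_sub_const]

/-- **Pointwise Leibniz bounds of orders `1, 2, 3` for `ψ • h`.** If at `x`: `|ψ| ≤ 1`, `|∂ψ| ≤ A₁`,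
`|∂²ψ| ≤ A₂`, `|∂³ψ| ≤ A₃`, `‖h‖ ≤ B` and `‖∂h‖, ‖∂²h‖, ‖∂³h‖ ≤ M`, then
`‖∂(ψ•h)‖ ≤ M + A₁B`, `‖∂²(ψ•h)‖ ≤ M + A₂B + 2A₁M`, `‖∂³(ψ•h)‖ ≤ M + A₃B + 3A₂M + 3A₁M` at `x`
(Evans §5.3, Leibniz formula). [folklore] -/
theorem flatLin_leibniz_bounds {F : Type*} [NormedAddCommGroup F] [NormedSpace ℝ F]
    {ψ : T3 → ℝ} {h : T3 → F} (hψ : Torus.IsSmooth ψ) (hh : Torus.IsSmooth h) {x : T3}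
    {A₁ A₂ A₃ B M : ℝ} (h0 : |ψ x| ≤ 1) (h1 : ∀ i, |Torus.partialDeriv i ψ x| ≤ A₁)
    (h2 : ∀ i j, |Torus.partialDeriv i (Torus.partialDeriv j ψ) x| ≤ A₂)
    (h3 : ∀ i j k, |Torus.partialDeriv i (Torus.partialDeriv j (Torus.partialDeriv k ψ)) x| ≤ A₃)
    (g0 : ‖h x‖ ≤ B) (g1 : ∀ i, ‖Torus.partialDeriv i h x‖ ≤ M)
    (g2 : ∀ i j, ‖Torus.partialDeriv i (Torus.partialDeriv j h) x‖ ≤ M)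
    (g3 : ∀ i j k, ‖Torus.partialDeriv i (Torus.partialDeriv j (Torus.partialDeriv k h)) x‖ ≤ M)
    (i j k : Fin 3) :
    ‖Torus.partialDeriv i (fun y => ψ y • h y) x‖ ≤ M + A₁ * B ∧
    ‖Torus.partialDeriv i (Torus.partialDeriv j (fun y => ψ y • h y)) x‖ ≤ M + A₂ * B + 2 * (A₁ * M) ∧
    ‖Torus.partialDeriv i (Torus.partialDeriv j (Torus.partialDeriv k (fun y => ψ y • h y))) x‖ ≤
      M + A₃ * B + 3 * (A₂ * M) + 3 * (A₁ * M) := by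
  have key : ∀ {a : ℝ} {v : F} {s t : ℝ}, |a| ≤ s → ‖v‖ ≤ t → ‖a • v‖ ≤ s * t :=
    fun ha hv => by
      rw [norm_smul, Real.norm_eq_abs]
      exact mul_le_mul ha hv (norm_nonneg _) ((abs_nonneg _).trans ha)
  refine ⟨?_, ?_, ?_⟩
  · have e := Torus.partialDeriv_smul_sub hψ hh i x
    rw [sub_eq_iff_eq_add'] at e
    rw [e]
    exact (norm_add_le_of_le (key h0 (g1 i)) (key (h1 i) g0)).trans (le_of_eq (by ring))
  · have e := Torus.partialDeriv₂_smul_sub hψ hh j i x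
    rw [sub_eq_iff_eq_add'] at e
    rw [e]
    exact (norm_add_le_of_le (key h0 (g2 i j)) (norm_add_le_of_le (norm_add_le_of_le
      (key (h2 i j) g0) (key (h1 j) (g1 i))) (key (h1 i) (g1 j)))).trans (le_of_eq (by ring))
  · have e := Torus.partialDeriv₃_smul_sub hψ hh k j i x
    rw [sub_eq_iff_eq_add'] at e
    rw [e]
    exact (norm_add_le_of_le (key h0 (g3 i j k)) (norm_add_le_of_le (norm_add_le_of_le
      (norm_add_le_of_le (norm_add_le_of_le (norm_add_le_of_le (norm_add_le_of_le
      (key (h3 i j k) g0) (key (h2 j k) (g1 i))) (key (h2 i k) (g1 j))) (key (h1 k) (g2 i j)))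
      (key (h2 i j) (g1 k))) (key (h1 j) (g2 i k))) (key (h1 i) (g2 j k)))).trans (le_of_eq (by ring))

/-- The bookkeeping of the constants: with `|∂ᵏψ| ≤ A/rᵏ`, `‖h‖ ≤ 6Mr`, `0 < r ≤ 1`, the Leibniz bounds are
`≤ (12A + 6) M r^{-k}`. [folklore] -/
theorem flatLin_arith {A M r : ℝ} (hA : 0 ≤ A) (hM : 0 ≤ M) (hr : 0 < r) (hr1 : r ≤ 1) :
    6 * M * r ≤ (12 * A + 6) * M * r ∧ M + A / r * (6 * M * r) ≤ (12 * A + 6) * M ∧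
    M + A / r ^ 2 * (6 * M * r) + 2 * (A / r * M) ≤ (12 * A + 6) * M / r ∧
    M + A / r ^ 3 * (6 * M * r) + 3 * (A / r ^ 2 * M) + 3 * (A / r * M) ≤ (12 * A + 6) * M / r ^ 2 := by
  have hAM : 0 ≤ A * M := mul_nonneg hA hM
  have hAMr : 0 ≤ A * M * r := mul_nonneg hAM hr.le
  have hr0 : r ≠ 0 := hr.ne'
  refine ⟨by nlinarith, ?_, ?_, ?_⟩
  · have e : A / r * (6 * M * r) = 6 * (A * M) := by field_simp
    rw [e]; nlinarith
  · rw [le_div_iff₀ hr]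
    have e : (M + A / r ^ 2 * (6 * M * r) + 2 * (A / r * M)) * r = M * r + 8 * (A * M) := by
      field_simp; ring
    rw [e]
    nlinarith [mul_le_of_le_one_right hM hr1]
  · rw [le_div_iff₀ (pow_pos hr 2)]
    have e : (M + A / r ^ 3 * (6 * M * r) + 3 * (A / r ^ 2 * M) + 3 * (A / r * M)) * r ^ 2 =
        M * r ^ 2 + 9 * (A * M) + 3 * (A * M) * r := by
      field_simp; ring
    rw [e]
    have h1 : M * r ^ 2 ≤ M := mul_le_of_le_one_right hM (pow_le_one₀ hr.le hr1)
    have h2 : 3 * (A * M) * r ≤ 3 * (A * M) := mul_le_of_le_one_right (by positivity) hr1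
    nlinarith

/-! ## The linear flattening -/

/-- **The linear flattening at scale `r`.** For a cutoff `ψ` as in `flatLin_exists_cutoff` (constant
`A ≥ 1`, `0 < r ≤ 1`) and a smooth field `w` with `C⁰…C³` bounds `M`, the field `ψ w + (1 - ψ) w(c)` is
smooth, agrees with `w` on `B(c, r)`, equals `w(c)` off `B(c, 2r)`, and deviates from `w(c)` at scale `r`
with slope `(12A + 6) M`. [folklore] -/
theorem flatLin_flatten {F : Type*} [NormedAddCommGroup F] [NormedSpace ℝ F] {A r : ℝ} (hA : 1 ≤ A)
    (hr : 0 < r) (hr1 : r ≤ 1) {c : T3} {ψ : T3 → ℝ} (hψs : Torus.IsSmooth ψ)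
    (hψ01 : ∀ x, 0 ≤ ψ x ∧ ψ x ≤ 1) (hψ1 : ∀ x, Torus.euclidDist x c < r → ψ x = 1)
    (hψ0 : ∀ x, 3 / 2 * r ≤ Torus.euclidDist x c → ψ x = 0)
    (hψd : ∀ x, ∀ i j k : Fin 3, |Torus.partialDeriv i ψ x| ≤ A / r ∧
      |Torus.partialDeriv i (Torus.partialDeriv j ψ) x| ≤ A / r ^ 2 ∧
      |Torus.partialDeriv i (Torus.partialDeriv j (Torus.partialDeriv k ψ)) x| ≤ A / r ^ 3)
    {M : ℝ} {w : T3 → F} (hw : Torus.IsSmooth w)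
    (hwb : ∀ x, ‖w x‖ ≤ M ∧ ∀ i j k : Fin 3, ‖Torus.partialDeriv i w x‖ ≤ M ∧
      ‖Torus.partialDeriv i (Torus.partialDeriv j w) x‖ ≤ M ∧
      ‖Torus.partialDeriv i (Torus.partialDeriv j (Torus.partialDeriv k w)) x‖ ≤ M) :
    Torus.IsSmooth (fun x => ψ x • w x + (1 - ψ x) • w c) ∧
    (∀ x, Torus.euclidDist x c < r → ψ x • w x + (1 - ψ x) • w c = w x) ∧
    (∀ x, 2 * r ≤ Torus.euclidDist x c → ψ x • w x + (1 - ψ x) • w c = w c) ∧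
    ∀ x, ‖ψ x • w x + (1 - ψ x) • w c - w c‖ ≤ (12 * A + 6) * M * r ∧ ∀ i j k : Fin 3,
      ‖Torus.partialDeriv i (fun x => ψ x • w x + (1 - ψ x) • w c) x‖ ≤ (12 * A + 6) * M ∧
      ‖Torus.partialDeriv i (Torus.partialDeriv j (fun x => ψ x • w x + (1 - ψ x) • w c)) x‖ ≤
        (12 * A + 6) * M / r ∧
      ‖Torus.partialDeriv i (Torus.partialDeriv j (Torus.partialDeriv k
        (fun x => ψ x • w x + (1 - ψ x) • w c))) x‖ ≤ (12 * A + 6) * M / r ^ 2 := by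
  have hM : 0 ≤ M := (norm_nonneg _).trans (hwb c).1
  have hA0 : 0 ≤ A := zero_le_one.trans hA
  -- the deviation `h = w - w c` and the product `P = ψ • h`; `g = P + w c`
  have hhs : Torus.IsSmooth (fun x => w x - w c) := hw.sub (Torus.isSmooth_const (w c))
  have hPs : Torus.IsSmooth (fun x => ψ x • (w x - w c)) := hψs.smul' hhs
  have hg_eq : (fun x => ψ x • w x + (1 - ψ x) • w c) = fun x => ψ x • (w x - w c) + w c := by
    funext x
    rw [smul_sub, sub_smul, one_smul]
    abel
  have hpt : ∀ x, ψ x • w x + (1 - ψ x) • w c - w c = ψ x • (w x - w c) := fun x => by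
    rw [smul_sub, sub_smul, one_smul]
    abel
  have hD : ∀ i, Torus.partialDeriv i (fun x => ψ x • w x + (1 - ψ x) • w c) =
      Torus.partialDeriv i (fun x => ψ x • (w x - w c)) := fun i => by
    rw [hg_eq]
    exact flatLin_partialDeriv_add_const _ _ i
  have hDh : ∀ i, Torus.partialDeriv i (fun x => w x - w c) = Torus.partialDeriv i w := fun i =>
    flatLin_partialDeriv_sub_const w (w c) i
  refine ⟨?_, fun x hx => ?_, fun x hx => ?_, fun x => ?_⟩
  · rw [hg_eq]; exact hPs.add (Torus.isSmooth_const (w c))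
  · rw [hψ1 x hx]; simp
  · rw [hψ0 x (by linarith)]; simp
  have hnn : 0 ≤ (12 * A + 6) * M := by positivity
  by_cases hfar : 3 / 2 * r < Torus.euclidDist x c
  · -- far from `c`: `P` vanishes identically near `x`
    have hcont : Continuous fun y : T3 => Torus.euclidDist y c :=
      (Torus.continuous_norm_reprSym (d := Fin 3)).comp (continuous_id.sub continuous_const)
    have hU : IsOpen {y : T3 | 3 / 2 * r < Torus.euclidDist y c} := isOpen_lt continuous_const hcont
    have hPU : ∀ y ∈ {y : T3 | 3 / 2 * r < Torus.euclidDist y c}, ψ y • (w y - w c) = 0 := fun y hy => by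
      rw [hψ0 y (le_of_lt hy), zero_smul]
    refine ⟨?_, fun i j k => ?_⟩
    · rw [hpt x, hPU x hfar, norm_zero]; positivity
    obtain ⟨e1, e2, e3⟩ := flatLin_derivs_eq_zero_of_isOpen hU hPU i j k hfar
    rw [hD i, hD j, hD k, e1, e2, e3, norm_zero]
    exact ⟨hnn, by positivity, by positivity⟩
  · -- near `c`: Leibniz bounds, the smallness `‖w x - w c‖ ≤ 6 M r` pays for the `r⁻¹` of `∂ψ`
    have hxc : Torus.euclidDist x c ≤ 3 / 2 * r := not_lt.1 hfar
    have hB : ‖w x - w c‖ ≤ 6 * M * r := by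
      have hL := we_norm_sub_le_of_norm_partialDeriv_le hw (fun i y => ((hwb y).2 i i i).1) x c
      have hd : dist x c ≤ Torus.euclidDist x c := by
        rw [dist_eq_norm]; exact Torus.norm_sub_le_euclidDist_holds x c
      calc ‖w x - w c‖ ≤ 3 * M * dist x c := hL
        _ ≤ 3 * M * (3 / 2 * r) := mul_le_mul_of_nonneg_left (hd.trans hxc) (by positivity)
        _ ≤ 6 * M * r := by nlinarith [mul_nonneg hM hr.le]
    have hψx : |ψ x| ≤ 1 := abs_le.2 ⟨by linarith [(hψ01 x).1], (hψ01 x).2⟩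
    obtain ⟨a0, a1, a2, a3⟩ := flatLin_arith hA0 hM hr hr1
    refine ⟨?_, fun i j k => ?_⟩
    · rw [hpt x, norm_smul, Real.norm_eq_abs]
      exact (mul_le_mul hψx hB (norm_nonneg _) zero_le_one).trans (by rw [one_mul]; exact a0)
    have hL := flatLin_leibniz_bounds (A₁ := A / r) (A₂ := A / r ^ 2) (A₃ := A / r ^ 3) hψs hhs hψx
      (fun i => (hψd x i i i).1) (fun i j => (hψd x i j j).2.1) (fun i j k => (hψd x i j k).2.2) hB
      (fun i => by rw [hDh i]; exact ((hwb x).2 i i i).1)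
      (fun i j => by rw [hDh j]; exact ((hwb x).2 i j j).2.1)
      (fun i j k => by rw [hDh k]; exact ((hwb x).2 i j k).2.2) i j k
    rw [hD i, hD j, hD k]
    exact ⟨hL.1.trans a1, hL.2.1.trans a2, hL.2.2.trans a3⟩

/-- **Registered stub `stub_flatteningLinear` (line Sketch of crux `ConeLocalisation`).** Smooth cutoffs on
`𝕋³` with an absolute constant `Cψ` and the scale-`r` bounds of the linear flattenings
`ψ f + (1 - ψ) f(c)`, `ψ w + (1 - ψ) w(c)` of fields with `C⁰…C³` bounds `M`. [folklore] -/
theorem stub_flatteningLinear : FlatteningLinear := by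
  obtain ⟨A, hA, hcut⟩ := flatLin_exists_cutoff
  have hA0 : 0 ≤ A := zero_le_one.trans hA
  refine ⟨12 * A + 6, by positivity, fun r hr hr16 c => ?_⟩
  have hr1 : r ≤ 1 := hr16.trans (by norm_num)
  obtain ⟨ψ, hψs, hψ01, hψ1, hψ0, hψd⟩ := hcut r hr hr16 c
  have hAC : ∀ n : ℕ, A / r ^ n ≤ (12 * A + 6) / r ^ n := fun n =>
    div_le_div_of_nonneg_right (by linarith) (pow_pos hr n).le
  refine ⟨ψ, hψs, hψ01, hψ1, fun x hx => hψ0 x (by linarith), fun x i j k => ?_, fun M hM => ⟨?_, ?_⟩⟩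
  · obtain ⟨h1, h2, h3⟩ := hψd x i j k
    refine ⟨h1.trans ?_, h2.trans (hAC 2), h3.trans (hAC 3)⟩
    simpa using hAC 1
  · intro f hf hfb
    have H := flatLin_flatten hA hr hr1 hψs hψ01 hψ1 hψ0 hψd hf (M := M)
      (fun x => by simpa only [Real.norm_eq_abs] using hfb x)
    simpa only [ScaleDeviation, smul_eq_mul, Real.norm_eq_abs] using H
  · intro w hw hwb
    exact flatLin_flatten hA hr hr1 hψs hψ01 hψ1 hψ0 hψd hw hwb

end Summit.AtomisticToContinuum.HydrodynamicLimit.Theorems.ConeLocalisation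

end
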